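import Summits.CriticalPhenomena.PercolationContinuityZ3.Theorems.Transplant.SkelFrmBChoiceResidC
import Summits.CriticalPhenomena.PercolationContinuityZ3.Theorems.Transplant.SkelFrmBChoiceResidF2
import Summits.CriticalPhenomena.PercolationContinuityZ3.Theorems.Transplant.SkelFrmBChoiceDepthYW
import Summits.CriticalPhenomena.PercolationContinuityZ3.Theorems.Transplant.SkelFrmBChoiceDepth2
import Summits.CriticalPhenomena.PercolationContinuityZ3.Theorems.Transplant.SkelFrmBParamsBridge0
import Summits.CriticalPhenomena.PercolationContinuityZ3.Theorems.Transplant.SkelFrmBParamsBridgeF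
import HarnessLib

/-!
# N2 (frames-only node `SamePDropOfSkeletonFrm₁`, OPEN) — (ζ″) under (R-44)/(R-47): THE NODE TUPLE's RESIDUAL UNIONS `gxQ/fxQ/exQ/mxQ/PxQ` AT THE WIDER
# WINDOWS and their domination lemmas (the `_of_le` wrappers' only hypotheses; lead g12 11:03:36Z (1), 12:52:21Z)

The node tuple of record (V letters, lead 11:46:03Z / stmt 12:50:55Z) reads
`frmChoiceAllQ3V (KS.gT 0 (gxQ 0 …)) (KS.fT 0 (fxQ 0 …)) (KS.PR 0 (PxQ 0 …)) (NegB.SUS (exQ 0 …) (mxQ …)) (NegB.cR2W 0) (NegB.hFR 0) NegB.BSlot.small3`; each residual is the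
pointwise UNION of the columns' residual slot FUNCTIONS: (C) `gxC/fxC/exC` (SkelFrmBChoiceResidC) plus the two depth floors at the wider windows `ZD2 + 4`
(SkelFrmBChoiceDepth2) and `ZDYW + 4` (SkelFrmBChoiceDepthYW); (F) `gxFc mk (cF κ)/fxFc mk/exFc mk (cF κ)` (SkelFrmBChoiceResidF) and the wrapper residual `exF2 mk (cF κ)` (SkelFrmBChoiceResidF2, hp-8 g44) and `KS.PxF (cF κ) mk` at the
face index **`cF κ := 1000·Kq + 1`**; (R) PARAMETERS `gxR fxR exR mxR PxR`; and ONE cross-column member ((R-47)(b), lead 12:52:21Z: the g-floor may read the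
f-slot VALUE; p3's amendment 13:34:28Z): `2·KS.fT mk (fxQ …) + 5·R′0 + 3 ≤ gxQ ≤ KS.gT mk (gxQ …)` (**`two_fT_le_gT`** = p3's `hfg`).
* `cF`, `gxQ mk gxR fxR`, `fxQ mk fxR`, `exQ mk exR`, `mxQ mxR`, `PxQ mk PxR`; `le_gxQ` (4), `two_fT_le_gT`, `le_fxQ`, `le_exQ` (5), `exF2_le_exQ`, `mxQ_at`, `subset_PxQ`;
  `le_gT_gxQ`, `le_fT_fxQ`, `subset_PR_PxQ`; `Hg_Q`, `Hex_Q` (`ZD2`), `HexY_Q` (`ZDYW`), `πBud_le_Lp_Q`, `exQ_le_Lp`.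
NON-VACUITY: every residual is a free slot; a `max`/`∪` of floors is jointly satisfiable by construction (the unions ARE the witnesses).
builds on p205010 (kernel theorem, internal audit signed; external expert review pending) — nothing in this file uses p205010; NOTHING is claimed about the
open node `SamePDropOfSkeletonFrm₁`.
Lane `prim-bschramm`, seat `prim-bschramm-stmt` (gen 21); helper file (`--supports stmt-CriticalPhenomena-4575 --as helper`).
[cite: KozmaNitzan2024, §4 Lemma 12 (pp. 23–25), p. 30 (Step IV)] [cite: MartineauTassion2017, §4.3 Lemma 4.2]
-/

open scoped Classical

noncomputable section

namespace Summit.CriticalPhenomena.PercolationContinuityZ3.Theorems.Transplant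

namespace PlanarSkeletonFrm

namespace NegB

open Literature.Probability.Percolation Literature.Probability.LatticeModels SimpleGraph
open SkelConc (Consts)
open Skelφ.StepI (DataNS OutNS)
open Neg

/-- **The face index of record** `cF κ := 1000·Kq + 1` (N1: `cFA`/`cK`). [this work] -/
def cF (κ : Consts) : ℕ := 1000 * Neg.Kq κ + 1

/-- `cF = 1000·Kq + 1 ≥ 1001`. [folklore] -/
theorem cF_eq (κ : Consts) : cF κ = 1000 * Neg.Kq κ + 1 ∧ 1001 ≤ cF κ := by
  have := Neg.one_le_Kq κ; unfold cF; omega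

section Unions

variable (mk : ℕ) (gxR fxR : Neg.FSlot) (exR mxR : GSlot) (PxR : PSlot)

/-- **The node's width residual** `fxQ := fxC ⊔ fxFc ⊔ fxR`. [this work] -/
def fxQ : Neg.FSlot := fun κ _ _ _ _ _ Φ t p D => max (fxC mk κ Φ t p D) (max (fxFc mk κ Φ t p D) (fxR κ Φ t p D))

/-- **The node's box residual** `gxQ := gxC ⊔ gxFc (cF κ) ⊔ gxR ⊔ (2·fT + 5·R′0 + 3)` — the last member READS THE WIDTH SLOT VALUE `KS.fT mk (fxQ …)`
((R-47)(b) as amended by p3-g17 13:12:37Z/13:34:28Z: the second-axis cross link at the prefix's minimal window needs `2f + 5R′0 + 2 ≤ g − 1`;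
lead g12 12:52:21Z: slot order `f` before `g`). [this work] -/
def gxQ : Neg.FSlot := fun κ _ _ _ _ _ Φ t p D =>
  max (gxC mk κ Φ t p D) (max (gxFc mk (cF κ) κ Φ t p D) (max (gxR κ Φ t p D) (2 * KS.fT mk (fxQ mk fxR) κ Φ t p D + 5 * KS0.R'0 κ Φ t p D mk + 3)))

/-- **The node's excess residual** `exQ := exC ⊔ (ZD2 + 4) ⊔ (ZDYW + 4) ⊔ exFc (cF κ) ⊔ exF2 (cF κ) ⊔ exR` (the two depth floors at the wider windows; `exF2` =
hp-8's (F)-wrapper residual, SkelFrmBChoiceResidF2). [this work] -/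
def exQ : GSlot := fun κ _ _ _ _ _ Φ t p D g f =>
  max (exC mk κ Φ t p D g f) (max (ZD2 κ Φ t p D g f + 4) (max (ZDYW κ Φ t p D g f + 4) (max (exFc mk (cF κ) κ Φ t p D g f) (max (exF2 mk (cF κ) κ Φ t p D g f) (exR κ Φ t p D g f)))))

/-- **The node's rim-diameter residual** `mxQ := mxR` (the (C) floor is built into `mRS`; the slot only forwards the (R)/(F) demand). [this work] -/
def mxQ : GSlot := fun κ _ _ _ _ _ Φ t p D g f => mxR κ Φ t p D g f

/-- **The node's extra-pair slot** `PxQ := Px0 ∪ PxF (cF κ) ∪ PxR` (admissibility inherited from the three members). [this work] -/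
def PxQ : PSlot := fun κ _ _ _ _ _ Φ t p D =>
  ⟨(KS.Px0 mk κ Φ t p D).1 ∪ ((KS.PxF (cF κ) mk κ Φ t p D).1 ∪ (PxR κ Φ t p D).1), fun q hq => by
    rcases Finset.mem_union.1 hq with h | h
    · exact (KS.Px0 mk κ Φ t p D).2 q h
    · rcases Finset.mem_union.1 h with h' | h'
      · exact (KS.PxF (cF κ) mk κ Φ t p D).2 q h'
      · exact (PxR κ Φ t p D).2 q h'⟩

variable (κ : Consts) {V : Type} [DecidableEq V] [Countable V] {G : SimpleGraph V} [G.LocallyFinite] (Φ : PlanarSkeletonFrm G) (t : V) (p : unitInterval)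
  (D : DataNS V) (g f : ℕ)

/-- The four box-residual dominations (the last: `2·fT + 5·R′0 + 3 ≤ gxQ`). [folklore] -/
theorem le_gxQ : gxC mk κ Φ t p D ≤ gxQ mk gxR fxR κ Φ t p D ∧ gxFc mk (cF κ) κ Φ t p D ≤ gxQ mk gxR fxR κ Φ t p D ∧ gxR κ Φ t p D ≤ gxQ mk gxR fxR κ Φ t p D ∧
    2 * KS.fT mk (fxQ mk fxR) κ Φ t p D + 5 * KS0.R'0 κ Φ t p D mk + 3 ≤ gxQ mk gxR fxR κ Φ t p D :=
  ⟨le_max_left _ _, (le_max_left _ _).trans (le_max_right _ _), ((le_max_left _ _).trans (le_max_right _ _)).trans (le_max_right _ _),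
    ((le_max_right _ _).trans (le_max_right _ _)).trans (le_max_right _ _)⟩

/-- **THE (R-47)(b) CROSS-COLUMN ROW at the composed slots** (p3-g17's `hfg`): `2·fT + 5·R′0 + 3 ≤ KS.gT mk (gxQ …)`. [this work] -/
theorem two_fT_le_gT : 2 * KS.fT mk (fxQ mk fxR) κ Φ t p D + 5 * KS0.R'0 κ Φ t p D mk + 3 ≤ KS.gT mk (gxQ mk gxR fxR) κ Φ t p D :=
  (le_gxQ mk gxR fxR κ Φ t p D).2.2.2.trans (KS.gT_floors κ Φ t p D mk (gxQ mk gxR fxR)).2.2.2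

/-- The three width-residual dominations. [folklore] -/
theorem le_fxQ : fxC mk κ Φ t p D ≤ fxQ mk fxR κ Φ t p D ∧ fxFc mk κ Φ t p D ≤ fxQ mk fxR κ Φ t p D ∧ fxR κ Φ t p D ≤ fxQ mk fxR κ Φ t p D :=
  ⟨le_max_left _ _, (le_max_left _ _).trans (le_max_right _ _), (le_max_right _ _).trans (le_max_right _ _)⟩

/-- The five excess-residual dominations. [folklore] -/
theorem le_exQ : exC mk κ Φ t p D g f ≤ exQ mk exR κ Φ t p D g f ∧ ZD2 κ Φ t p D g f + 4 ≤ exQ mk exR κ Φ t p D g f ∧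
    ZDYW κ Φ t p D g f + 4 ≤ exQ mk exR κ Φ t p D g f ∧ exFc mk (cF κ) κ Φ t p D g f ≤ exQ mk exR κ Φ t p D g f ∧ exR κ Φ t p D g f ≤ exQ mk exR κ Φ t p D g f := by
  unfold exQ
  refine ⟨le_max_left _ _, ?_, ?_, ?_, ?_⟩
  · exact (le_max_left _ _).trans (le_max_right _ _)
  · exact ((le_max_left _ _).trans (le_max_right _ _)).trans (le_max_right _ _)
  · exact (((le_max_left _ _).trans (le_max_right _ _)).trans (le_max_right _ _)).trans (le_max_right _ _)
  · exact ((((le_max_right _ _).trans (le_max_right _ _)).trans (le_max_right _ _)).trans (le_max_right _ _)).trans (le_max_right _ _)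

/-- **hp-8's wrapper residual inside `exQ`**: `exF2 mk (cF κ) ≤ exQ` (the (F) node file's hypothesis (3) verbatim; `exF2` = SkelFrmBChoiceResidF2). [folklore] -/
theorem exF2_le_exQ : exF2 mk (cF κ) κ Φ t p D g f ≤ exQ mk exR κ Φ t p D g f := by
  unfold exQ
  exact ((((le_max_left _ _).trans (le_max_right _ _)).trans (le_max_right _ _)).trans (le_max_right _ _)).trans (le_max_right _ _)

/-- `mxQ` forwards `mxR` (by `rfl`). [folklore] -/
theorem mxQ_at : mxQ mxR κ Φ t p D g f = mxR κ Φ t p D g f := rfl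

/-- The three pair-slot inclusions. [folklore] -/
theorem subset_PxQ : (KS.Px0 mk κ Φ t p D).1 ⊆ (PxQ mk PxR κ Φ t p D).1 ∧ (KS.PxF (cF κ) mk κ Φ t p D).1 ⊆ (PxQ mk PxR κ Φ t p D).1 ∧
    (PxR κ Φ t p D).1 ⊆ (PxQ mk PxR κ Φ t p D).1 :=
  ⟨Finset.subset_union_left, Finset.subset_union_left.trans Finset.subset_union_right, Finset.subset_union_right.trans Finset.subset_union_right⟩

end Unions

/-! ## The dominations at the composed slots `KS.gT mk (gxQ …)` / `KS.fT mk (fxQ …)` (the `_of_le` wrappers' hypotheses, verbatim) -/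

section AtSlots

variable (mk : ℕ) (gxR fxR : Neg.FSlot) (κ : Consts) {V : Type} [DecidableEq V] [Countable V] {G : SimpleGraph V} [G.LocallyFinite] (Φ : PlanarSkeletonFrm G)
  (t : V) (p : unitInterval) (D : DataNS V)

/-- `gxC ≤ gT (gxQ)`, `gxFc (cF κ) ≤ gT (gxQ)`, `gxR ≤ gT (gxQ)` (`gxQ ≤ gT`, `KS.gT_floors`). [folklore] -/
theorem le_gT_gxQ : gxC mk κ Φ t p D ≤ KS.gT mk (gxQ mk gxR fxR) κ Φ t p D ∧ gxFc mk (cF κ) κ Φ t p D ≤ KS.gT mk (gxQ mk gxR fxR) κ Φ t p D ∧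
    gxR κ Φ t p D ≤ KS.gT mk (gxQ mk gxR fxR) κ Φ t p D := by
  have h := (KS.gT_floors κ Φ t p D mk (gxQ mk gxR fxR)).2.2.2
  obtain ⟨h1, h2, h3, -⟩ := le_gxQ mk gxR fxR κ Φ t p D
  exact ⟨h1.trans h, h2.trans h, h3.trans h⟩

/-- `fxC ≤ fT (fxQ)`, `fxFc ≤ fT (fxQ)`, `fxR ≤ fT (fxQ)` (`fxQ ≤ fT`, `KS.fT_floors`). [folklore] -/
theorem le_fT_fxQ : fxC mk κ Φ t p D ≤ KS.fT mk (fxQ mk fxR) κ Φ t p D ∧ fxFc mk κ Φ t p D ≤ KS.fT mk (fxQ mk fxR) κ Φ t p D ∧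
    fxR κ Φ t p D ≤ KS.fT mk (fxQ mk fxR) κ Φ t p D := by
  have h := (KS.fT_floors κ Φ t p D mk (fxQ mk fxR)).2.2.2
  obtain ⟨h1, h2, h3⟩ := le_fxQ mk fxR κ Φ t p D
  exact ⟨h1.trans h, h2.trans h, h3.trans h⟩

/-- The three members are in the composed pair slot `KS.PR mk (PxQ …)` (`PR mk Px ⊇ Px`). [folklore] -/
theorem subset_PR_PxQ (PxR : PSlot) : (KS.Px0 mk κ Φ t p D).1 ⊆ (KS.PR mk (PxQ mk PxR) κ Φ t p D).1 ∧ (KS.PxF (cF κ) mk κ Φ t p D).1 ⊆ (KS.PR mk (PxQ mk PxR) κ Φ t p D).1 ∧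
    (PxR κ Φ t p D).1 ⊆ (KS.PR mk (PxQ mk PxR) κ Φ t p D).1 := by
  obtain ⟨h1, h2, h3⟩ := subset_PxQ mk PxR κ Φ t p D
  have h : (PxQ mk PxR κ Φ t p D).1 ⊆ (KS.PR mk (PxQ mk PxR) κ Φ t p D).1 := fun q hq => Finset.mem_union_right _ hq
  exact ⟨h1.trans h, h2.trans h, h3.trans h⟩

end AtSlots

/-! ## The (C) floor families at the tuple (`HX_Q`/`HY_Q`'s `Hg`, `Hex`, `HexY`) -/

section Discharge

variable {κ : Consts} {V : Type} [DecidableEq V] [Countable V] {G : SimpleGraph V} [G.LocallyFinite] {Φ : PlanarSkeletonFrm G} {t : V} {p : unitInterval}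
  (mk : ℕ) (gxR fxR : Neg.FSlot) (exR : GSlot)

/-- **`Hg` at the tuple**: `gFloorKG ≤ KS.gT mk (gxQ …)` and `40·K·R′0 ≤ KS.gT mk (gxQ …)` (`gxC ≤ gxQ ≤ gT`). [folklore] -/
theorem Hg_Q (D : DataNS V) :
    gFloorKG κ Φ t p D mk ≤ KS.gT mk (gxQ mk gxR fxR) κ Φ t p D ∧ 40 * Neg.K κ * KS0.R'0 κ Φ t p D mk ≤ KS.gT mk (gxQ mk gxR fxR) κ Φ t p D :=
  Hg_of_ge (fun D => ((le_gxQ mk gxR fxR κ Φ t p D).1).trans (KS.gT_floors κ Φ t p D mk (gxQ mk gxR fxR)).2.2.2) D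

/-- **`Hex` at the tuple, wider windows**: `KS0.r₀0 t D mk (RLD …) + 3 ≤ exQ` and `ZD2 + 4 ≤ exQ`. [folklore] -/
theorem Hex_Q (D : DataNS V) (g f : ℕ) :
    KS0.r₀0 t D mk (RLD κ Φ t p D g f) + 3 ≤ exQ mk exR κ Φ t p D g f ∧ ZD2 κ Φ t p D g f + 4 ≤ exQ mk exR κ Φ t p D g f :=
  ⟨(Hex_of_ge (fun D g f => (le_exQ mk exR κ Φ t p D g f).1) D g f).1, (le_exQ mk exR κ Φ t p D g f).2.1⟩

/-- **`HexY` at the tuple, wider windows**: `KS0.r₀0 t D mk (RLD …) + 3 ≤ exQ` and `ZDYW + 4 ≤ exQ`. [folklore] -/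
theorem HexY_Q (D : DataNS V) (g f : ℕ) :
    KS0.r₀0 t D mk (RLD κ Φ t p D g f) + 3 ≤ exQ mk exR κ Φ t p D g f ∧ ZDYW κ Φ t p D g f + 4 ≤ exQ mk exR κ Φ t p D g f :=
  ⟨(Hex_Q mk exR D g f).1, (le_exQ mk exR κ Φ t p D g f).2.2.1⟩

/-- **The packager's monotone step `ex ≤ r`** (p1-g18 11:00:51Z): at the excess slot `SUS (exQ …) mx`, the face reach budgets sit below the radius
`r := Prm.Lp (SUS …)` — `πBudX/πBudY ≤ exFc (cF κ) ≤ exQ ≤ Lp` (`hπX/hπY_of_ge`, `ex_le_Lp_US`); any `mx`, any running density `q`. [folklore] -/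
theorem πBud_le_Lp_Q (mx : GSlot) (D : DataNS V) (g f : ℕ) (q : unitInterval) :
    KS.πBudX κ Φ t p D (cF κ) mk g f ≤ Skelφ.Prm.Lp (SUS (exQ mk exR) mx κ Φ t p D g f q) ∧
      KS.πBudY κ Φ t p D (cF κ) mk g f ≤ Skelφ.Prm.Lp (SUS (exQ mk exR) mx κ Φ t p D g f q) := by
  have hle := (ex_le_Lp_US κ Φ t p D g f (exQ mk exR) mx q).1
  exact ⟨(hπX_of_ge (fun D g f => (le_exQ mk exR κ Φ t p D g f).2.2.2.1) D g f).trans hle,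
    (hπY_of_ge (fun D g f => (le_exQ mk exR κ Φ t p D g f).2.2.2.1) D g f).trans hle⟩

/-- `exQ ≤ Lp (SUS (exQ …) mx) ≤ E₀ (…)` (re-export of `ex_le_Lp_US` at the union). [folklore] -/
theorem exQ_le_Lp (mx : GSlot) (D : DataNS V) (g f : ℕ) (q : unitInterval) :
    exQ mk exR κ Φ t p D g f ≤ Skelφ.Prm.Lp (SUS (exQ mk exR) mx κ Φ t p D g f q) ∧
      Skelφ.Prm.Lp (SUS (exQ mk exR) mx κ Φ t p D g f q) ≤ Skelφ.Prm.E₀ (SUS (exQ mk exR) mx κ Φ t p D g f q) :=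
  ex_le_Lp_US κ Φ t p D g f (exQ mk exR) mx q

end Discharge

end NegB

end PlanarSkeletonFrm

end Summit.CriticalPhenomena.PercolationContinuityZ3.Theorems.Transplant

end
-- build-touch 2026-08-25T07:00:05Z T1-A (lead g18): re-land of p389070, declarations byte-identical
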